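import Literature.AlgebraicGeometry.AbelianSchemes.SerreTensorConstruction
import Mathlib.CategoryTheory.Comma.Over.Pullback
import HarnessLib

/-!
# Base change of ring actions, of the fixed subgroup scheme `Fix(e)` of an idempotent (`Fix(e)_{S'} ≅ Fix(e_{S'})`), and of the
# powers (`(Aⁿ)_{S'} ≅ (A_{S'})ⁿ`) of an abelian scheme

Topic `AlgebraicGeometry/AbelianSchemes`, namespace `Literature.AlgebraicGeometry.AbelianSchemes.AbelianSchemeOver` (constructions with
bodies + proved theorems; no named fact, no `sorry`, no `instance`, no notation; any base change `g : S' ⟶ S`).  Cell `hodgecm-mathlib`,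
F0/P6 «MOD», P6a organ (g2) FILE 4a (the base-change half the moduli-functor consumers need; FILE 4b `SerreTensorBaseChange` assembles
`(A ⊗_𝒪 𝔟)_{S'} ≅ A_{S'} ⊗_𝒪 𝔟`); `--supports stmt-HodgeConjecture-24832`, count-neutral.  HC_CM is proved only modulo the 2 remaining
named inputs (hLiu418, h413) until rung 0 closes; this file discharges none of them.

## Mathematics ([GortzWedhorn2020] Section (4.7): base change `X ↦ X ×_S S'` is a functor commuting with fibre products)

`A ↦ A_{S'} := A ×_S S'` is the cartesian-monoidal functor `Over.pullback g` (★ `AbelianSchemeOver.baseChange`; Mathlib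
`Functor.grpObjObj`), so it maps homomorphisms to homomorphisms and preserves the group law on points (`Functor.map_mul`): a ring action
`ι : 𝒪 → End_S(A)` base-changes to `ι_{S'}(a) := ι(a)_{S'}` (§1).  For an idempotent endomorphism `e` of `B`, the retract identities
`π ≫ ι = e`, `ι ≫ π = 𝟙`, `ι ≫ e = ι` of ★ FILE 1 base-change verbatim, and `hom := ι_{S'} ≫ π'`, `inv := ι' ≫ π_{S'}` are inverse
ISOMORPHISMS `Fix(e)_{S'} ≅ Fix(e_{S'})` of `S'`-group schemes compatible with the inclusions — no limit-preservation argument is needed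
(§2).  For the powers, the coordinates `(pr_k)_{S'}` assemble to a homomorphism `(Aⁿ)_{S'} ⟶ (A_{S'})ⁿ` whose inverse comes from the
adjunction `Over.map g ⊣ Over.pullback g` (Mathlib `Over.mapPullbackAdj`): a `T`-point of `(Aⁿ)_{S'}` is an `(Over.map g).obj T`-point
of `Aⁿ`, i.e. an `n`-tuple of such points of `A`, i.e. an `n`-tuple of `T`-points of `A_{S'}` (§3).

## Contents

* §1 `isMonHom_pullback_map`, `pullback_map_mul∕_one`, **`RingAction.baseChange act g : (A.baseChange g).RingAction O`** (`_i`);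
* §2 for `e : B.X ⟶ B.X`: `endBC g e : (B.baseChange g).X ⟶ (B.baseChange g).X` (`= e_{S'}`; `endBC_idem`, `endBC_comp_and_id`,
  `isMonHom_endBC`), `ιBC∕πBC` (`= ι_{S'}, π_{S'}`, homs; `πBC_comp_ιBC`, `ιBC_comp_πBC`, `ιBC_comp_endBC`), the carriers
  `fixedOverBC∕fixedιBC∕fixedπBC` of `Fix(e_{S'})` (FILE 1 at `B_{S'}` with the instance `IsMonHom e_{S'}` supplied by name),
  **`fixedBaseChangeIso g e he : ((fixed e he).baseChange g).X ≅ fixedOverBC g e`** (`_hom_ι`, `_inv_ι`, `isMonHom_fixedBaseChangeIso`);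
* §3 `powProjBC`, **`powBC g A n : ((A.pow n).baseChange g).X ⟶ ((A.baseChange g).pow n).X`** (`powBC_powProj`, `isMonHom_powBC`),
  `powBCInv` (`powBCInv_powProjBC`, `powBCInv_comp_powBC`, `powBC_comp_powBCInv`), **`powBaseChangeIso`** (`isMonHom_powBaseChangeIso`).

## References
* [GortzWedhorn2020] U. Görtz, T. Wedhorn, *Algebraic Geometry I*, 2nd ed., Section (4.7) (pp. 107–108) (base change), Def. 9.1 (3) ∕
  Prop. 9.3 (equalizers); [Kottwitz1992] §5 (p. 390) (`𝒪_B`-action).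
* Mathlib: `CategoryTheory.Comma.Over.Pullback` (`Over.mapPullbackAdj`), `CategoryTheory.Monoidal.Cartesian.Over` (`(Over.pullback f).Braided`),
  `Functor.map.instIsMonHom`, `Functor.map_mul∕map_one`.  Tree: ★ `AbelianSchemes/SerreTensorConstruction` (FILE 2) and its imports.
-/

noncomputable section

universe u

open CategoryTheory CategoryTheory.Limits AlgebraicGeometry MonoidalCategory CartesianMonoidalCategory
open scoped MonObj CategoryTheory.Obj

namespace Literature.AlgebraicGeometry.AbelianSchemes

namespace AbelianSchemeOver

variable {S S' : Scheme.{u}} (g : S' ⟶ S)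

/-! ## §1 Base change of homomorphisms and of ring actions -/

section Hom

variable {A B : AbelianSchemeOver S}

/-- The base change `f_{S'} : A_{S'} → B_{S'}` of a homomorphism of abelian schemes is a homomorphism (a monoidal functor maps
homomorphisms to homomorphisms, Mathlib `Functor.map.instIsMonHom`). [cite: GortzWedhorn2020, Section (4.7) (pp. 107–108)] -/
theorem isMonHom_pullback_map (f : A.X ⟶ B.X) [IsMonHom f] :
    IsMonHom (M := (A.baseChange g).X) (N := (B.baseChange g).X) ((Over.pullback g).map f) :=
  inferInstanceAs (IsMonHom ((Over.pullback g).map f))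

/-- Base change preserves the pointwise product of morphisms into an abelian scheme: `(f * f')_{S'} = f_{S'} * f'_{S'}`
(Mathlib `Functor.map_mul`). [cite: GortzWedhorn2020, Section (4.7) (pp. 107–108)] -/
theorem pullback_map_mul {T : Over S} (f f' : T ⟶ B.X) :
    ((Over.pullback g).map (f * f') : (Over.pullback g).obj T ⟶ (B.baseChange g).X) =
      ((Over.pullback g).map f : (Over.pullback g).obj T ⟶ (B.baseChange g).X) * (Over.pullback g).map f' :=
  Functor.map_mul (Over.pullback g) f f'

/-- Base change preserves the unit morphism: `(1)_{S'} = 1`. [cite: GortzWedhorn2020, Section (4.7) (pp. 107–108)] -/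
theorem pullback_map_one {T : Over S} :
    ((Over.pullback g).map (1 : T ⟶ B.X) : (Over.pullback g).obj T ⟶ (B.baseChange g).X) = 1 :=
  Functor.map_one (Over.pullback g)

variable {O : Type*} [CommRing O]

/-- **Base change of a ring action**: `ι_{S'}(a) := ι(a)_{S'}`. [cite: Kottwitz1992, §5 (p. 390)] -/
def RingAction.baseChange (act : A.RingAction O) : (A.baseChange g).RingAction O where
  i a := (Over.pullback g).map (act.i a)
  isMonHom a := by
    haveI := act.isMonHom a
    exact isMonHom_pullback_map g (act.i a)
  i_one := by rw [act.i_one]; exact (Over.pullback g).map_id _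
  i_mul a b := by rw [act.i_mul]; exact (Over.pullback g).map_comp _ _
  i_zero := by rw [act.i_zero]; exact pullback_map_one g
  i_add a b := by rw [act.i_add]; exact pullback_map_mul g _ _

/-- `(act.baseChange g).i a = (ι a)_{S'}`. [cite: Kottwitz1992, §5 (p. 390)] -/
@[simp] theorem RingAction.baseChange_i (act : A.RingAction O) (a : O) :
    (act.baseChange g).i a = (Over.pullback g).map (act.i a) := rfl

end Hom

/-! ## §2 Base change of the fixed subgroup scheme of an idempotent: `Fix(e)_{S'} ≅ Fix(e_{S'})` -/

section Fixed

variable {B : AbelianSchemeOver S} (e : B.X ⟶ B.X)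

/-- `e_{S'} : B_{S'} ⟶ B_{S'}` (typed on the carrier `(B.baseChange g).X`). [cite: GortzWedhorn2020, Section (4.7) (pp. 107–108)] -/
def endBC : (B.baseChange g).X ⟶ (B.baseChange g).X := (Over.pullback g).map e

/-- `e_{S'}` is idempotent when `e` is. [cite: GortzWedhorn2020, Section (4.7) (pp. 107–108)] -/
theorem endBC_idem (he : e ≫ e = e) : endBC g e ≫ endBC g e = endBC g e := by
  change (Over.pullback g).map e ≫ (Over.pullback g).map e = (Over.pullback g).map e
  rw [← Functor.map_comp, he]

/-- `(e ≫ e')_{S'} = e_{S'} ≫ e'_{S'}` and `(𝟙)_{S'} = 𝟙`. [cite: GortzWedhorn2020, Section (4.7) (pp. 107–108)] -/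
theorem endBC_comp_and_id (e' : B.X ⟶ B.X) : endBC g (e ≫ e') = endBC g e ≫ endBC g e' ∧ endBC g (𝟙 B.X) = 𝟙 _ := by
  refine ⟨(Over.pullback g).map_comp e e', ?_⟩
  change (Over.pullback g).map (𝟙 B.X) = _
  rw [CategoryTheory.Functor.map_id]
  rfl

variable [IsMonHom e] (he : e ≫ e = e)

/-- `e_{S'}` is a homomorphism. [cite: GortzWedhorn2020, Section (4.7) (pp. 107–108)] -/
theorem isMonHom_endBC : IsMonHom (endBC g e) := isMonHom_pullback_map g e

/-- `ι_{S'} : Fix(e)_{S'} ⟶ B_{S'}` (typed on the carriers). [cite: GortzWedhorn2020, Section (4.7) (pp. 107–108)] -/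
def ιBC : ((fixed e he).baseChange g).X ⟶ (B.baseChange g).X := (Over.pullback g).map (fixedι e)

/-- `π_{S'} : B_{S'} ⟶ Fix(e)_{S'}` (typed on the carriers). [cite: GortzWedhorn2020, Section (4.7) (pp. 107–108)] -/
def πBC : (B.baseChange g).X ⟶ ((fixed e he).baseChange g).X := (Over.pullback g).map (fixedπ e he)

/-- `ι_{S'}`, `π_{S'}` are homomorphisms. [cite: GortzWedhorn2020, Section (4.7) (pp. 107–108)] -/
theorem isMonHom_ιBC_πBC : IsMonHom (ιBC g e he) ∧ IsMonHom (πBC g e he) := by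
  haveI : IsMonHom (M := (fixed e he).X) (fixedι e) := isMonHom_fixedι e
  haveI : IsMonHom (N := (fixed e he).X) (fixedπ e he) := isMonHom_fixedπ e he
  exact ⟨isMonHom_pullback_map g (A := fixed e he) (B := B) (fixedι e),
    isMonHom_pullback_map g (A := B) (B := fixed e he) (fixedπ e he)⟩

/-- `π_{S'} ≫ ι_{S'} = e_{S'}`. [cite: GortzWedhorn2020, Section (4.7) (pp. 107–108)] -/
@[reassoc]
theorem πBC_comp_ιBC : πBC g e he ≫ ιBC g e he = endBC g e := by
  change (Over.pullback g).map (fixedπ e he) ≫ (Over.pullback g).map (fixedι e) = (Over.pullback g).map e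
  rw [← Functor.map_comp, fixedπ_comp_ι]

/-- `ι_{S'} ≫ π_{S'} = 𝟙`. [cite: GortzWedhorn2020, Section (4.7) (pp. 107–108)] -/
@[reassoc]
theorem ιBC_comp_πBC : ιBC g e he ≫ πBC g e he = 𝟙 _ := by
  change (Over.pullback g).map (fixedι e) ≫ (Over.pullback g).map (fixedπ e he) = _
  rw [← Functor.map_comp, fixedι_comp_π, CategoryTheory.Functor.map_id]
  rfl

/-- `ι_{S'} ≫ e_{S'} = ι_{S'}`. [cite: GortzWedhorn2020, Section (4.7) (pp. 107–108)] -/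
@[reassoc]
theorem ιBC_comp_endBC : ιBC g e he ≫ endBC g e = ιBC g e he := by
  change (Over.pullback g).map (fixedι e) ≫ (Over.pullback g).map e = (Over.pullback g).map (fixedι e)
  rw [← Functor.map_comp, fixedι_comp]

/-- `Fix(e_{S'})`, the fixed subgroup scheme of `e_{S'}` on `B_{S'}` (instance `IsMonHom e_{S'}` supplied by name).
[cite: GortzWedhorn2020, Definition 9.1 (3) and Proposition 9.3] -/
abbrev fixedOverBC : Over S' := @fixedOver S' (B.baseChange g) (endBC g e) (isMonHom_endBC g e)

/-- `ι' : Fix(e_{S'}) ⟶ B_{S'}`. [cite: GortzWedhorn2020, Definition 9.1 (3) and Proposition 9.3] -/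
abbrev fixedιBC : fixedOverBC g e ⟶ (B.baseChange g).X := @fixedι S' (B.baseChange g) (endBC g e) (isMonHom_endBC g e)

/-- `π' : B_{S'} ⟶ Fix(e_{S'})`. [cite: GortzWedhorn2020, Definition 9.1 (3) and Proposition 9.3] -/
abbrev fixedπBC : (B.baseChange g).X ⟶ fixedOverBC g e :=
  @fixedπ S' (B.baseChange g) (endBC g e) (isMonHom_endBC g e) (endBC_idem g e he)

/-- **`Fix(e)_{S'} ≅ Fix(e_{S'})`** (in `Over S'`): `hom := ι_{S'} ≫ π'`, `inv := ι' ≫ π_{S'}` — the retract identities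
`π ≫ ι = e`, `ι ≫ π = 𝟙`, `ι ≫ e = ι` base-change and recombine (no limit-preservation argument is needed).
[cite: GortzWedhorn2020, Section (4.7) (pp. 107–108)] -/
def fixedBaseChangeIso : ((fixed e he).baseChange g).X ≅ fixedOverBC g e where
  hom := ιBC g e he ≫ fixedπBC g e he
  inv := fixedιBC g e ≫ πBC g e he
  hom_inv_id := by
    haveI := isMonHom_endBC g e
    rw [Category.assoc, fixedπ_comp_ι_assoc, ιBC_comp_endBC_assoc, ιBC_comp_πBC]
  inv_hom_id := by
    haveI := isMonHom_endBC g e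
    rw [Category.assoc, πBC_comp_ιBC_assoc, fixedι_comp_assoc, fixedι_comp_π]

/-- `(Fix(e)_{S'} ≅ Fix(e_{S'})).hom ≫ ι' = ι_{S'}`. [cite: GortzWedhorn2020, Section (4.7) (pp. 107–108)] -/
@[reassoc]
theorem fixedBaseChangeIso_hom_ι : (fixedBaseChangeIso g e he).hom ≫ fixedιBC g e = ιBC g e he := by
  haveI := isMonHom_endBC g e
  change (ιBC g e he ≫ fixedπBC g e he) ≫ fixedιBC g e = _
  rw [Category.assoc, fixedπ_comp_ι, ιBC_comp_endBC]

/-- `(Fix(e)_{S'} ≅ Fix(e_{S'})).inv ≫ ι_{S'} = ι'`. [cite: GortzWedhorn2020, Section (4.7) (pp. 107–108)] -/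
@[reassoc]
theorem fixedBaseChangeIso_inv_ι : (fixedBaseChangeIso g e he).inv ≫ ιBC g e he = fixedιBC g e := by
  rw [Iso.inv_comp_eq, fixedBaseChangeIso_hom_ι]

/-- Both directions of `Fix(e)_{S'} ≅ Fix(e_{S'})` are homomorphisms. [cite: GortzWedhorn2020, Section (4.7) (pp. 107–108)] -/
theorem isMonHom_fixedBaseChangeIso :
    IsMonHom (fixedBaseChangeIso g e he).hom ∧ IsMonHom (fixedBaseChangeIso g e he).inv := by
  haveI := isMonHom_endBC g e
  haveI h1 : IsMonHom (fixedBaseChangeIso g e he).hom := by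
    haveI := (isMonHom_ιBC_πBC g e he).1
    haveI := @isMonHom_fixedπ S' (B.baseChange g) (endBC g e) (isMonHom_endBC g e) (endBC_idem g e he)
    change IsMonHom (ιBC g e he ≫ fixedπBC g e he)
    infer_instance
  exact ⟨h1, inferInstance⟩

end Fixed

/-! ## §3 Base change of the powers: `(Aⁿ)_{S'} ≅ (A_{S'})ⁿ` -/

section Pow

variable (A : AbelianSchemeOver S) (n : ℕ)

/-- `(pr_k)_{S'} : (Aⁿ)_{S'} ⟶ A_{S'}` (typed on the carriers). [cite: GortzWedhorn2020, Section (4.7) (pp. 107–108)] -/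
def powProjBC (k : Fin n) : ((A.pow n).baseChange g).X ⟶ (A.baseChange g).X := (Over.pullback g).map (A.powProj n k)

/-- `(pr_k)_{S'}` is a homomorphism. [cite: GortzWedhorn2020, Section (4.7) (pp. 107–108)] -/
theorem isMonHom_powProjBC (k : Fin n) : IsMonHom (powProjBC g A n k) := by
  haveI : IsMonHom (M := (A.pow n).X) (A.powProj n k) := A.isMonHom_powProj n k
  exact isMonHom_pullback_map g (A := A.pow n) (B := A) (A.powProj n k)

/-- **The comparison homomorphism `(Aⁿ)_{S'} ⟶ (A_{S'})ⁿ`**, coordinates `(pr_k)_{S'}`. [cite: GortzWedhorn2020, Section (4.7) (pp. 107–108)] -/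
def powBC : ((A.pow n).baseChange g).X ⟶ ((A.baseChange g).pow n).X := powLift fun k => powProjBC g A n k

/-- `powBC ≫ pr'_k = (pr_k)_{S'}`. [cite: GortzWedhorn2020, Section (4.7) (pp. 107–108)] -/
@[reassoc (attr := simp)]
theorem powBC_powProj (k : Fin n) : powBC g A n ≫ (A.baseChange g).powProj n k = powProjBC g A n k := by
  rw [powBC, powLift_powProj]

/-- `powBC` is a homomorphism. [cite: GortzWedhorn2020, Section (4.7) (pp. 107–108)] -/
theorem isMonHom_powBC : IsMonHom (powBC g A n) :=
  isMonHom_powLift _ fun k => isMonHom_powProjBC g A n k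

/-- The inverse comparison `(A_{S'})ⁿ ⟶ (Aⁿ)_{S'}`, built with the adjunction `Over.map g ⊣ Over.pullback g`: a `T`-point of
`(Aⁿ)_{S'}` is an `(Over.map g).obj T`-point of `Aⁿ`, i.e. an `n`-tuple of such points of `A`, i.e. an `n`-tuple of `T`-points of
`A_{S'}`. [cite: GortzWedhorn2020, Section (4.7) (pp. 107–108)] -/
def powBCInv : ((A.baseChange g).pow n).X ⟶ ((A.pow n).baseChange g).X :=
  (Over.mapPullbackAdj g).homEquiv _ (A.pow n).X
    (powLift fun k => ((Over.mapPullbackAdj g).homEquiv _ A.X).symm ((A.baseChange g).powProj n k))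

/-- `powBCInv ≫ (pr_k)_{S'} = pr'_k`. [cite: GortzWedhorn2020, Section (4.7) (pp. 107–108)] -/
@[reassoc (attr := simp)]
theorem powBCInv_powProjBC (k : Fin n) : powBCInv g A n ≫ powProjBC g A n k = (A.baseChange g).powProj n k := by
  change (Over.mapPullbackAdj g).homEquiv _ (A.pow n).X
      (powLift fun k => ((Over.mapPullbackAdj g).homEquiv _ A.X).symm ((A.baseChange g).powProj n k)) ≫
    (Over.pullback g).map (A.powProj n k) = _
  rw [← Adjunction.homEquiv_naturality_right, powLift_powProj, Equiv.apply_symm_apply]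

/-- `powBCInv ≫ powBC = 𝟙`. [cite: GortzWedhorn2020, Section (4.7) (pp. 107–108)] -/
@[reassoc (attr := simp)]
theorem powBCInv_comp_powBC : powBCInv g A n ≫ powBC g A n = 𝟙 _ :=
  pow_hom_ext fun k => by rw [Category.assoc, powBC_powProj, powBCInv_powProjBC, Category.id_comp]

/-- `powBC ≫ powBCInv = 𝟙`. [cite: GortzWedhorn2020, Section (4.7) (pp. 107–108)] -/
@[reassoc (attr := simp)]
theorem powBC_comp_powBCInv : powBC g A n ≫ powBCInv g A n = 𝟙 _ := by
  apply ((Over.mapPullbackAdj g).homEquiv _ (A.pow n).X).symm.injective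
  change ((Over.mapPullbackAdj g).homEquiv _ (A.pow n).X).symm (powBC g A n ≫ (Over.mapPullbackAdj g).homEquiv _ (A.pow n).X
      (powLift fun k => ((Over.mapPullbackAdj g).homEquiv _ A.X).symm ((A.baseChange g).powProj n k))) = _
  rw [Adjunction.homEquiv_naturality_left_symm, Equiv.symm_apply_apply]
  refine pow_hom_ext fun k => ?_
  rw [Category.assoc, powLift_powProj, ← Adjunction.homEquiv_naturality_left_symm]
  have hk : powBC g A n ≫ (A.baseChange g).powProj n k = 𝟙 _ ≫ (Over.pullback g).map (A.powProj n k) := by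
    rw [powBC_powProj, Category.id_comp]; rfl
  erw [hk]
  exact (Over.mapPullbackAdj g).homEquiv_naturality_right_symm (𝟙 _) (A.powProj n k)

/-- **`(Aⁿ)_{S'} ≅ (A_{S'})ⁿ`** as `S'`-schemes, both directions homomorphisms of `S'`-group schemes.
[cite: GortzWedhorn2020, Section (4.7) (pp. 107–108)] -/
def powBaseChangeIso : ((A.pow n).baseChange g).X ≅ ((A.baseChange g).pow n).X where
  hom := powBC g A n
  inv := powBCInv g A n
  hom_inv_id := powBC_comp_powBCInv g A n
  inv_hom_id := powBCInv_comp_powBC g A n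

/-- Both directions of `(Aⁿ)_{S'} ≅ (A_{S'})ⁿ` are homomorphisms. [cite: GortzWedhorn2020, Section (4.7) (pp. 107–108)] -/
theorem isMonHom_powBaseChangeIso : IsMonHom (powBaseChangeIso g A n).hom ∧ IsMonHom (powBaseChangeIso g A n).inv := by
  haveI : IsMonHom (powBaseChangeIso g A n).hom := isMonHom_powBC g A n
  exact ⟨‹_›, inferInstance⟩

end Pow

end AbelianSchemeOver

end Literature.AlgebraicGeometry.AbelianSchemes

end
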